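import Literature.Probability.Distributions.BetaGammaRatio
import Literature.MeasureTheory.TotalVariation.SetwiseBound
import HarnessLib

/-!
# `m·S₁/(S₁+S₂)` versus `Gamma(n,1)` in total variation

For independent `S₁ ∼ Gamma(n,1)`, `S₂ ∼ Gamma(p,1)` with integers `n, p ≥ 1` and an integer
`m` with `p ≤ m ≤ 2n + p`:

  `‖Law(m S₁/(S₁+S₂)) − Gamma(n,1)‖_TV ≤ 8 n²/m`   (`tvClose_betaGammaRatio`).

Proof (one-sided density criterion `tvClose_of_forall_le_add`): on `(0,m)` the law of the ratio
has density `q` (`ratioDensity_eq`) with `q/g = A·B`, `g` the `Gamma(n,1)` density,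
`A = Γ(n+p)/(Γ(p)mⁿ) ≥ 1 − 2n²/m` (`gamma_ratio_ge`, Bernoulli) and
`B = (1 − x/m)^{p−1} eˣ ≥ 1 − 2x²/m` for `x ≤ m/2` (`one_sub_div_pow_mul_exp_ge`); hence
`g ≤ q + ε g` a.e. with `ε(x) = (2n² + 2x² + 2x)/m` (for `x ≥ m/2`, `ε ≥ 1`), and
`∫ ε g = (2n² + 2n(n+1) + 2n)/m ≤ 8n²/m` by the Gamma moments.

This is the radial estimate behind the complex-coordinates Diaconis–Freedman bound
(file `SphereTruncationTV`).

## References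

* P. Diaconis, D. Freedman, *A dozen de Finetti-style results in search of a theory*,
  Ann. Inst. H. Poincaré Probab. Statist. 23 (1987) 397–423, Thm. 1 and §2.
-/

open MeasureTheory ProbabilityTheory Real Set
open scoped ENNReal NNReal

namespace Literature.Probability.Distributions

open Literature.MeasureTheory.TotalVariation
open Literature.Probability.RandomMatrix (measurable_gammaPDF)

/-! ### The two elementary inequalities -/

/-- `A = Γ(n+p)/(Γ(p) mⁿ) = ∏_{j<n} (p+j)/m ≥ (p/m)ⁿ ≥ 1 − n(m−p)/m ≥ 1 − 2n²/m` when
`m ≤ 2n + p` (Bernoulli's inequality). [folklore] -/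
theorem gamma_ratio_ge {n p m : ℕ} (hp : 1 ≤ p) (hm1 : 1 ≤ m) (hm : m ≤ 2 * n + p) :
    1 - 2 * (n:ℝ) ^ 2 / m ≤ Real.Gamma ((n:ℝ) + p) / (Real.Gamma p * (m:ℝ) ^ n) := by
  have hprod : ∀ k : ℕ, Real.Gamma ((k:ℝ) + p) = (∏ j ∈ Finset.range k, ((p:ℝ) + j)) * Real.Gamma p := by
    intro k
    induction k with
    | zero => simp
    | succ k ih =>
      rw [Finset.prod_range_succ, show ((k + 1 : ℕ) : ℝ) + p = ((k:ℝ) + p) + 1 by push_cast; ring,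
        Real.Gamma_add_one (by positivity), ih]
      ring
  have hp0 : (0:ℝ) < p := by exact_mod_cast hp
  have hΓp : 0 < Real.Gamma p := Real.Gamma_pos_of_pos hp0
  have hmpos : (0:ℝ) < m := by exact_mod_cast hm1
  rw [hprod n]
  have hA : (∏ j ∈ Finset.range n, ((p:ℝ) + j)) * Real.Gamma p / (Real.Gamma p * (m:ℝ) ^ n) =
      (∏ j ∈ Finset.range n, ((p:ℝ) + j)) / (m:ℝ) ^ n := by
    field_simp
  rw [hA]
  have hP : (p:ℝ) ^ n ≤ ∏ j ∈ Finset.range n, ((p:ℝ) + j) := by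
    calc (p:ℝ) ^ n = ∏ _j ∈ Finset.range n, (p:ℝ) := by rw [Finset.prod_const, Finset.card_range]
      _ ≤ ∏ j ∈ Finset.range n, ((p:ℝ) + j) :=
          Finset.prod_le_prod (fun j _ => hp0.le) fun j _ => by
            have : (0:ℝ) ≤ j := Nat.cast_nonneg j
            linarith
  have hB : 1 - (n:ℝ) * (((m:ℝ) - p) / m) ≤ ((p:ℝ) / m) ^ n := by
    have hb := one_add_mul_le_pow (a := (p:ℝ) / m - 1)
      (by have : (0:ℝ) ≤ p / m := by positivity
          linarith) n
    have e1 : 1 + ((p:ℝ) / m - 1) = p / m := by ring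
    have e2 : 1 + (n:ℝ) * ((p:ℝ) / m - 1) = 1 - n * ((m - p) / m) := by
      field_simp
      ring
    rw [e1, e2] at hb
    exact hb
  have hC : (n:ℝ) * (((m:ℝ) - p) / m) ≤ 2 * (n:ℝ) ^ 2 / m := by
    have hmle : (m:ℝ) ≤ 2 * n + p := by exact_mod_cast hm
    have h1 : (n:ℝ) * ((m:ℝ) - p) ≤ 2 * (n:ℝ) ^ 2 := by
      have hn0 : (0:ℝ) ≤ n := Nat.cast_nonneg n
      nlinarith
    calc (n:ℝ) * (((m:ℝ) - p) / m) = ((n:ℝ) * ((m:ℝ) - p)) / m := by ring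
      _ ≤ 2 * (n:ℝ) ^ 2 / m := div_le_div_of_nonneg_right h1 hmpos.le
  calc 1 - 2 * (n:ℝ) ^ 2 / m ≤ 1 - n * (((m:ℝ) - p) / m) := by linarith
    _ ≤ ((p:ℝ) / m) ^ n := hB
    _ = (p:ℝ) ^ n / (m:ℝ) ^ n := div_pow _ _ _
    _ ≤ (∏ j ∈ Finset.range n, ((p:ℝ) + j)) / (m:ℝ) ^ n :=
        div_le_div_of_nonneg_right hP (by positivity)

/-- `e^{−(t + 2t²)} ≤ 1 − t` for `0 ≤ t ≤ 1/2` (from `eᵘ ≥ 1 + u` and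
`(1 − t)(1 + t + 2t²) = 1 + t²(1 − 2t) ≥ 1`). [folklore] -/
theorem exp_neg_le_one_sub {t : ℝ} (h0 : 0 ≤ t) (h1 : t ≤ 1 / 2) :
    Real.exp (-(t + 2 * t ^ 2)) ≤ 1 - t := by
  have hu : 0 ≤ t + 2 * t ^ 2 := by positivity
  have h2 : Real.exp (-(t + 2 * t ^ 2)) ≤ (1 + (t + 2 * t ^ 2))⁻¹ := by
    rw [Real.exp_neg]
    exact inv_anti₀ (by positivity) (by linarith [Real.add_one_le_exp (t + 2 * t ^ 2)])
  have h3 : (1 + (t + 2 * t ^ 2))⁻¹ ≤ 1 - t := by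
    rw [inv_le_iff_one_le_mul₀ (by positivity)]
    nlinarith [sq_nonneg t, mul_nonneg (sq_nonneg t) h0]
  exact h2.trans h3

/-- `B = (1 − x/m)^k eˣ ≥ e^{−2x²/m} ≥ 1 − 2x²/m` for `k ≤ m` and `0 ≤ x ≤ m/2`. [folklore] -/
theorem one_sub_div_pow_mul_exp_ge {k : ℕ} {m x : ℝ} (hm : 0 < m) (hkm : (k:ℝ) ≤ m) (hx0 : 0 ≤ x)
    (hxm : x ≤ m / 2) : 1 - 2 * x ^ 2 / m ≤ (1 - x / m) ^ k * Real.exp x := by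
  set t := x / m with ht
  have ht0 : 0 ≤ t := by positivity
  have ht1 : t ≤ 1 / 2 := by rw [ht, div_le_iff₀ hm]; linarith
  have h1 : Real.exp (-(t + 2 * t ^ 2)) ≤ 1 - t := exp_neg_le_one_sub ht0 ht1
  have h2 : Real.exp (-(k * (t + 2 * t ^ 2))) ≤ (1 - t) ^ k := by
    rw [show -((k:ℝ) * (t + 2 * t ^ 2)) = k * (-(t + 2 * t ^ 2)) by ring, Real.exp_nat_mul]
    exact pow_le_pow_left₀ (Real.exp_nonneg _) h1 k
  have h3 : -(2 * x ^ 2 / m) ≤ x - k * (t + 2 * t ^ 2) := by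
    have hk0 : (0:ℝ) ≤ k := Nat.cast_nonneg k
    have hkm' : (k:ℝ) / m ≤ 1 := (div_le_one hm).2 hkm
    have e1 : (k:ℝ) * t = x * (k / m) := by rw [ht]; ring
    have e2 : (k:ℝ) * t ^ 2 = (x ^ 2 / m) * (k / m) := by rw [ht]; field_simp
    have i1 : (k:ℝ) * t ≤ x := by rw [e1]; nlinarith
    have i2 : (k:ℝ) * t ^ 2 ≤ x ^ 2 / m := by
      rw [e2]
      have : 0 ≤ x ^ 2 / m := by positivity
      nlinarith
    have e3 : (k:ℝ) * (t + 2 * t ^ 2) = k * t + 2 * (k * t ^ 2) := by ring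
    rw [e3]
    have e4 : -(2 * x ^ 2 / m) = -(2 * (x ^ 2 / m)) := by ring
    rw [e4]
    linarith
  calc 1 - 2 * x ^ 2 / m ≤ Real.exp (-(2 * x ^ 2 / m)) := by
        linarith [Real.add_one_le_exp (-(2 * x ^ 2 / m))]
    _ ≤ Real.exp (x - k * (t + 2 * t ^ 2)) := Real.exp_le_exp.2 h3
    _ = Real.exp (-(k * (t + 2 * t ^ 2))) * Real.exp x := by rw [← Real.exp_add]; ring_nf
    _ ≤ (1 - t) ^ k * Real.exp x := mul_le_mul_of_nonneg_right h2 (Real.exp_nonneg _)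

/-- The pointwise comparison on `(0, m/2]`: with `A ≥ 1 − a`, `B ≥ 1 − b`, `A, B, a, b ≥ 0`,
`A·B ≥ 1 − a − b`. [folklore] -/
theorem mul_ge_one_sub_add {A B a b : ℝ} (hA : 1 - a ≤ A) (hB : 1 - b ≤ B) (hA0 : 0 ≤ A)
    (hB0 : 0 ≤ B) (ha : 0 ≤ a) (hb : 0 ≤ b) : 1 - a - b ≤ A * B := by
  by_cases h1 : 1 - a ≤ 0
  · nlinarith [mul_nonneg hA0 hB0]
  by_cases h2 : 1 - b ≤ 0
  · nlinarith [mul_nonneg hA0 hB0]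
  push Not at h1 h2
  calc 1 - a - b ≤ (1 - a) * (1 - b) := by nlinarith
    _ ≤ A * B := mul_le_mul hA hB h2.le hA0

/-! ### The total-variation bound -/

/-- **`‖Law(m S₁/(S₁+S₂)) − Gamma(n,1)‖_TV ≤ 8n²/m`** for independent `S₁ ∼ Gamma(n,1)`,
`S₂ ∼ Gamma(p,1)`, integers `n, p ≥ 1` and `p ≤ m ≤ 2n + p`: the radial part of the comparison
between the first `n` coordinates of a uniform point on the sphere of radius `√m` in `ℂ^{n+p}`
and a standard complex Gaussian vector (a complex-coordinates form of Diaconis–Freedman's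
theorem, with an explicit constant adapted to `m ≈ n + p`). [folklore] -/
theorem tvClose_betaGammaRatio {n p m : ℕ} (hn : 1 ≤ n) (hp : 1 ≤ p) (hpm : p ≤ m)
    (hm : m ≤ 2 * n + p) :
    TVClose (((gammaMeasure n 1).prod (gammaMeasure p 1)).map
        (fun q : ℝ × ℝ => (m:ℝ) * q.1 / (q.1 + q.2)))
      (gammaMeasure n 1) (8 * (n:ℝ) ^ 2 / m) := by
  have hn0 : (0:ℝ) < n := by exact_mod_cast hn
  have hp0 : (0:ℝ) < p := by exact_mod_cast hp
  have hm1 : 1 ≤ m := le_trans hp hpm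
  have hm0 : (0:ℝ) < m := by exact_mod_cast hm1
  haveI := isProbabilityMeasure_gammaMeasure hn0 one_pos
  haveI := isProbabilityMeasure_gammaMeasure hp0 one_pos
  haveI : IsProbabilityMeasure (((gammaMeasure n 1).prod (gammaMeasure p 1)).map
      (fun q : ℝ × ℝ => (m:ℝ) * q.1 / (q.1 + q.2))) :=
    Measure.isProbabilityMeasure_map (by fun_prop)
  -- the error function and its integral
  set g : ℝ → ℝ≥0∞ := gammaPDF n 1 with hg
  set ε : ℝ → ℝ≥0∞ := fun x => ENNReal.ofReal (2 * (n:ℝ) ^ 2 / m) +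
    ENNReal.ofReal (2 / m) * ENNReal.ofReal (x ^ 2) + ENNReal.ofReal (2 / m) * ENNReal.ofReal x with hε
  have hεm : Measurable ε := by
    simp only [hε]; fun_prop
  have hgm : Measurable g := measurable_gammaPDF _ _
  have hδ : ∫⁻ x, g x * ε x = ENNReal.ofReal ((2 * (n:ℝ) ^ 2 + 2 * (n * (n + 1)) + 2 * n) / m) := by
    have e1 : ∀ x, g x * ε x = g x * ENNReal.ofReal (2 * (n:ℝ) ^ 2 / m) +
        ENNReal.ofReal (2 / m) * (g x * ENNReal.ofReal (x ^ 2)) +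
        ENNReal.ofReal (2 / m) * (g x * ENNReal.ofReal x) := fun x => by
      simp only [hε]; ring
    simp_rw [e1]
    have m2' : Measurable (fun x : ℝ => g x * ENNReal.ofReal (x ^ 2)) := hgm.mul (by fun_prop)
    have m3' : Measurable (fun x : ℝ => g x * ENNReal.ofReal x) := hgm.mul (by fun_prop)
    have m1 : Measurable (fun x : ℝ => g x * ENNReal.ofReal (2 * (n:ℝ) ^ 2 / m)) := hgm.mul_const _
    have m2 : Measurable (fun x : ℝ => ENNReal.ofReal (2 / m) * (g x * ENNReal.ofReal (x ^ 2))) :=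
      m2'.const_mul _
    have m12 : Measurable (fun x : ℝ => g x * ENNReal.ofReal (2 * (n:ℝ) ^ 2 / m) +
        ENNReal.ofReal (2 / m) * (g x * ENNReal.ofReal (x ^ 2))) := m1.add m2
    rw [lintegral_add_left m12, lintegral_add_left m1, lintegral_mul_const _ hgm,
      lintegral_const_mul _ m2', lintegral_const_mul _ m3']
    rw [hg, lintegral_gammaPDF_eq_one hn0 one_pos, one_mul, lintegral_gammaPDF_mul_sq hn0,
      lintegral_gammaPDF_mul_id hn0, ← ENNReal.ofReal_mul (by positivity),
      ← ENNReal.ofReal_mul (by positivity), ← ENNReal.ofReal_add (by positivity) (by positivity),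
      ← ENNReal.ofReal_add (by positivity) (by positivity)]
    congr 1
    field_simp
  have hδfin : ∫⁻ x, g x * ε x ≠ ∞ := by rw [hδ]; exact ENNReal.ofReal_ne_top
  have hδle : (∫⁻ x, g x * ε x).toReal ≤ 8 * (n:ℝ) ^ 2 / m := by
    rw [hδ, ENNReal.toReal_ofReal (by positivity)]
    rw [div_le_div_iff_of_pos_right hm0]
    have hn1 : (1:ℝ) ≤ n := by exact_mod_cast hn
    nlinarith
  refine (tvClose_of_forall_le_add hδfin fun E hE => ?_).mono hδle
  -- `Gamma(n,1) E ≤ β E + δ`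
  set R : ℝ → ℝ≥0∞ := (Ioo (0:ℝ) m).indicator (ratioDensity n p m) with hR
  -- the pointwise (a.e.) inequality `g ≤ R + g ε`
  have hpt : ∀ x : ℝ, x ≠ 0 → g x ≤ R x + g x * ε x := by
    intro x hx
    rcases lt_or_gt_of_ne hx with hneg | hpos
    · simp only [hg]; rw [gammaPDF_of_neg hneg]; exact bot_le
    by_cases hbig : (m:ℝ) / 2 ≤ x
    · -- `ε x ≥ 1`
      have h1 : 1 ≤ ε x := by
        have e : (1:ℝ≥0∞) = ENNReal.ofReal (2 / m) * ENNReal.ofReal ((m:ℝ) / 2) := by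
          rw [← ENNReal.ofReal_mul (by positivity), ← ENNReal.ofReal_one]
          congr 1; field_simp
        calc (1:ℝ≥0∞) = ENNReal.ofReal (2 / m) * ENNReal.ofReal ((m:ℝ) / 2) := e
          _ ≤ ENNReal.ofReal (2 / m) * ENNReal.ofReal x := by gcongr
          _ ≤ ε x := by simp only [hε]; exact le_add_self
      calc g x = g x * 1 := (mul_one _).symm
        _ ≤ g x * ε x := by gcongr
        _ ≤ R x + g x * ε x := le_add_self
    · push Not at hbig
      have hxm : x < m := by linarith
      have hxI : x ∈ Ioo (0:ℝ) m := ⟨hpos, hxm⟩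
      -- real densities
      set a : ℝ := 2 * (n:ℝ) ^ 2 / m with ha
      set b : ℝ := 2 * x ^ 2 / m with hb
      have ha0 : 0 ≤ a := by positivity
      have hb0 : 0 ≤ b := by positivity
      set A : ℝ := Real.Gamma ((n:ℝ) + p) / (Real.Gamma p * (m:ℝ) ^ n) with hAdef
      set B : ℝ := (1 - x / m) ^ (p - 1) * Real.exp x with hBdef
      have hΓn := Real.Gamma_pos_of_pos hn0
      have hΓp := Real.Gamma_pos_of_pos hp0
      have hΓnp := Real.Gamma_pos_of_pos (by linarith : (0:ℝ) < n + p)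
      have hA0 : 0 ≤ A := by positivity
      have hxm1 : 0 ≤ 1 - x / m := by
        rw [sub_nonneg, div_le_one hm0]; exact hxm.le
      have hB0 : 0 ≤ B := by positivity
      have hA : 1 - a ≤ A := gamma_ratio_ge hp hm1 hm
      have hB : 1 - b ≤ B := by
        have hk : ((p - 1 : ℕ) : ℝ) ≤ m := by
          have : ((p - 1 : ℕ) : ℝ) ≤ p := by exact_mod_cast Nat.sub_le p 1
          have : (p:ℝ) ≤ m := by exact_mod_cast hpm
          linarith
        exact one_sub_div_pow_mul_exp_ge hm0 hk hpos.le hbig.le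
      have hAB : 1 - a - b ≤ A * B := mul_ge_one_sub_add hA hB hA0 hB0 ha0 hb0
      -- the Gamma density and the ratio density as reals
      set gg : ℝ := (Real.Gamma n)⁻¹ * x ^ (n - 1) * Real.exp (-x) with hgg
      have hgg0 : 0 ≤ gg := by positivity
      have hgx : g x = ENNReal.ofReal gg := by simp only [hg]; exact gammaPDF_natCast hn hpos.le
      have hRx : R x = ENNReal.ofReal (A * B * gg) := by
        simp only [hR]
        rw [Set.indicator_of_mem hxI, ratioDensity_eq hn hp hxI]
        congr 1
        -- `q = A B gg`
        simp only [hAdef, hBdef, hgg]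
        obtain ⟨p', rfl⟩ : ∃ p', p = p' + 1 := ⟨p - 1, by omega⟩
        simp only [Nat.add_sub_cancel, show n + (p' + 1) - 1 = n + p' by omega]
        have hxn : x ≠ 0 := hpos.ne'
        have hmn : (m:ℝ) ≠ 0 := hm0.ne'
        have hexp : Real.exp x ≠ 0 := (Real.exp_pos x).ne'
        have hdm : (1 - x / (m:ℝ)) = ((m:ℝ) - x) / m := by field_simp
        rw [hdm, div_pow, Real.exp_neg, pow_add]
        field_simp
      rw [hgx, hRx]
      have hre : gg ≤ A * B * gg + gg * (a + b) := by nlinarith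
      calc ENNReal.ofReal gg ≤ ENNReal.ofReal (A * B * gg + gg * (a + b)) := ENNReal.ofReal_le_ofReal hre
        _ = ENNReal.ofReal (A * B * gg) + ENNReal.ofReal gg * (ENNReal.ofReal a + ENNReal.ofReal b) := by
            rw [ENNReal.ofReal_add (by positivity) (by positivity), ENNReal.ofReal_mul hgg0,
              ENNReal.ofReal_add ha0 hb0]
        _ ≤ ENNReal.ofReal (A * B * gg) + ENNReal.ofReal gg * ε x := by
            gcongr
            simp only [hε, ha, hb]
            rw [show 2 * x ^ 2 / (m:ℝ) = 2 / m * x ^ 2 by ring, ENNReal.ofReal_mul (by positivity)]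
            exact le_self_add
  have hae : ∀ᵐ x ∂(volume : Measure ℝ), g x ≤ R x + g x * ε x := by
    rw [ae_iff]
    refine measure_mono_null (fun x hx => ?_) (measure_singleton (0:ℝ))
    by_contra h0
    exact hx (hpt x h0)
  -- integrate over `E`
  have hβE := map_ratio_apply (n := (n:ℝ)) hp0 hm0 hE
  have hRE : ∫⁻ x in E, R x = ((gammaMeasure n 1).prod (gammaMeasure p 1)).map
      (fun q : ℝ × ℝ => (m:ℝ) * q.1 / (q.1 + q.2)) E := by
    rw [hβE, ← lintegral_indicator hE, ← lintegral_indicator measurableSet_Ioo]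
    refine lintegral_congr fun x => ?_
    simp only [hR, Set.indicator, Set.mem_Ioo, Pi.one_apply]
    split_ifs <;> simp
  have hge : Measurable (fun x : ℝ => g x * ε x) := hgm.mul hεm
  rw [gammaMeasure, withDensity_apply _ hE]
  calc ∫⁻ x in E, gammaPDF n 1 x
      ≤ ∫⁻ x in E, R x + g x * ε x := lintegral_mono_ae (ae_restrict_of_ae hae)
    _ = (∫⁻ x in E, R x) + ∫⁻ x in E, g x * ε x := lintegral_add_right _ hge
    _ ≤ ((gammaMeasure n 1).prod (gammaMeasure p 1)).map
          (fun q : ℝ × ℝ => (m:ℝ) * q.1 / (q.1 + q.2)) E + ∫⁻ x, g x * ε x :=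
        add_le_add (le_of_eq hRE) (setLIntegral_le_lintegral _ _)

end Literature.Probability.Distributions
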